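import Literature.Probability.Percolation.Percolation
import HarnessLib

/-!
# `NoHeavyLowerTail` (stmt-CriticalPhenomena-4575) — DEFINITIONS: two-terminal series–parallel hub networks

Definitions file (`--supports stmt-CriticalPhenomena-4575`; prover `prim-ineq-prove-2` gen 12) for the formal statement of
**THEOREM SP** (memo `run/shared/lean/prim/prim-ineq-prove-2/THEOREM-SP.md`): for a finite graph with independent edge
weights, three distinct vertices `a, b, c`, if the `a–b` part of the graph avoiding the hub `c` is a two-terminal
series–parallel network (the hub `c` joined to any of its vertices), then
`Cov(1{a ↔ c}, 1{b ↔ c}) ≤ P(ab|c) · log (P(a ↔ b off c) / P(ab|c))` — Gladkov–Zimin Conj. 6.3 / Gladkov Conj. 10.1 on that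
class with modulus `w log (1/w)`.  The composition steps are already tree theorems for arbitrary weighted graphs
(`GZGluingLaw.parallel_cov_le`, `GZSeriesStep.series_cov_le`); this file only fixes the SYNTAX of the class so that the
induction can be stated (no named facts, no sorries, nothing probabilistic).

* `GZSP.IsSPNet c E a b` — the edge set `E : Finset (Sym2 V)` is a two-terminal series–parallel HUB NETWORK with terminals
  `a, b` and hub `c`: generated from single edges `s(a, b)` (`a, b, c` pairwise distinct) by attaching a hub edge `s(a, c)`
  or `s(b, c)` at a terminal, by SERIES composition at a middle terminal `m` (edge-disjoint parts whose vertex sets meet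
  only inside `{m, c}`, the far terminals off the other part) and by PARALLEL composition (edge-disjoint parts with the same
  terminals whose vertex sets meet only inside `{a, b, c}`).  The side conditions are literally the hypotheses of the
  measure-level gluing theorems `GZSeriesLaw.series_law_*` / `GZGluingLaw.parallel_law` with `Vᵢ :=` the vertex set
  spanned by `Eᵢ`.  Every vertex of such a network lies on an `a–b` path of non-hub edges, and every finite two-terminal
  series–parallel graph (Duffin 1965) with an arbitrary set of hub edges arises this way (attach each hub edge `s(x, c)` to
  one chosen non-hub edge at `x` before composing).

Design notes.  Edge sets are `Finset`s (the gluing theorems take `Finset`s for the independence lemma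
`prodBernoulli_real_inter_of_determinedBy_disjoint`); `open scoped Classical` supplies decidability for `insert`/`∪` as
in the sibling files.  Vertex sets are not an index: the spanned vertex set `{z | ∃ e ∈ E, z ∈ e}` is used inline.
Subgraphs hanging off the network at a single vertex ((PEND) of the memo) and components missing `a, b` are deliberately
NOT part of the syntax (they change nothing in the three-point law but would complicate the induction).
(Pattern: Duffin 1965, two-terminal series–parallel graphs; Moore–Shannon 1956.)
-/

namespace Summit.CriticalPhenomena.PercolationContinuityZ3.Theorems

namespace GZSP

open scoped Classical

variable {V : Type*}

/-- **Two-terminal series–parallel hub network** `IsSPNet c E a b` (terminals `a, b`, hub `c`, edge set `E`): the least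
class of edge sets containing the single edges `{s(a, b)}` (`a, b, c` pairwise distinct) and closed under attaching the hub
edge `s(a, c)` / `s(b, c)` at a terminal, SERIES composition at a middle terminal `m` (edge-disjoint parts, spanned vertex
sets meeting only inside `{m, c}`, `a` off `E₂`, `b` off `E₁`) and PARALLEL composition (edge-disjoint parts with the same
terminals, spanned vertex sets meeting only inside `{a, b, c}`).  The non-hub edges form a two-terminal series–parallel
graph in the sense of Duffin 1965 / Moore–Shannon 1956 and every such graph with any set of hub edges arises. [folklore] -/
inductive IsSPNet (c : V) : Finset (Sym2 V) → V → V → Prop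
  /-- the single edge `ab` (no hub edge yet), `a, b, c` pairwise distinct -/
  | edge {a b : V} (hab : a ≠ b) (hac : a ≠ c) (hbc : b ≠ c) : IsSPNet c {s(a, b)} a b
  /-- attach the hub edge `ac` at the left terminal -/
  | hubLeft {E : Finset (Sym2 V)} {a b : V} (h : IsSPNet c E a b) (he : s(a, c) ∉ E) :
      IsSPNet c (insert s(a, c) E) a b
  /-- attach the hub edge `bc` at the right terminal -/
  | hubRight {E : Finset (Sym2 V)} {a b : V} (h : IsSPNet c E a b) (he : s(b, c) ∉ E) :
      IsSPNet c (insert s(b, c) E) a b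
  /-- series composition of an `(a, m)`-network and an `(m, b)`-network at `m` -/
  | series {E₁ E₂ : Finset (Sym2 V)} {a m b : V} (h₁ : IsSPNet c E₁ a m) (h₂ : IsSPNet c E₂ m b)
      (hd : Disjoint E₁ E₂) (hS : ∀ z : V, (∃ e ∈ E₁, z ∈ e) → (∃ e ∈ E₂, z ∈ e) → z = m ∨ z = c)
      (ha : ∀ e ∈ E₂, a ∉ e) (hb : ∀ e ∈ E₁, b ∉ e) : IsSPNet c (E₁ ∪ E₂) a b
  /-- parallel composition of two `(a, b)`-networks -/
  | parallel {E₁ E₂ : Finset (Sym2 V)} {a b : V} (h₁ : IsSPNet c E₁ a b) (h₂ : IsSPNet c E₂ a b)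
      (hd : Disjoint E₁ E₂) (hS : ∀ z : V, (∃ e ∈ E₁, z ∈ e) → (∃ e ∈ E₂, z ∈ e) → z = a ∨ z = b ∨ z = c) :
      IsSPNet c (E₁ ∪ E₂) a b

end GZSP

end Summit.CriticalPhenomena.PercolationContinuityZ3.Theorems
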